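import Mathlib
import Summits.ValiantsHypothesis.ValiantsHypothesis.Theorems.ChowBorderDepth3ChowBorderBoundDefs

/-!
# Stub `stub_quotDerivCalc` of crux `ChowBorderDepth3.ChowBorderBound`
# (stmt-ValiantsHypothesis-5936), line `registered`

The calculus of the quotient-derivative numerators
`quotDerivNum f g w = g^(|w|+1) · ∂_w (f / g)` (the fraction-free carrier of the exact
divide–derive calculus), three folklore identities, each proved by induction on the word `w`
from the defining recursion `quotDerivNum_nil` / `quotDerivNum_cons`:

* (a) the reduction `ε ↦ 0`, i.e. the `ℂ`-algebra map
  `red : MvPolynomial (Option (Fin n × Fin n)) ℂ → MvPolynomial (Fin n × Fin n) ℂ`,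
  `X none ↦ 0`, `X (some v) ↦ X v`, commutes with `quotDerivNum` along words of matrix
  variables: `red (quotDerivNum f g (u.map some)) = quotDerivNum (red f) (red g) u`
  (because `red ∘ ∂_{some v} = ∂_v ∘ red`);
* (b) a common factor of numerator and denominator comes out as a power:
  `quotDerivNum (f E) (g E) u = E^(|u|+1) · quotDerivNum f g u` (indeed `(fE)/(gE) = f/g`);
* (c) a denominator factor `c` killed by every derivative of the word comes out as
  `quotDerivNum f (c g) u = c^|u| · quotDerivNum f g u` (indeed `∂_w (f/(cg)) = c⁻¹ ∂_w (f/g)`).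

References: P. Dutta, P. Dwivedi, N. Saxena, *Demystifying the border of depth-3 algebraic
circuits*, FOCS 2021 (DiDIL, §3); folklore calculus.
-/

-- `Summit.ValiantsHypothesis.ValiantsHypothesis.…` is the tree's mandated single-conjunct layout
-- (Sub = Summit), so the duplicated namespace component is intended.
set_option linter.dupNamespace false

namespace Summit.ValiantsHypothesis.ValiantsHypothesis.Theorems.ChowBorderBound.QuotDerivCalc

open MvPolynomial
open Summit.ValiantsHypothesis.ValiantsHypothesis.Theorems.ChowBorderBound.QuotDeriv

/-- The reduction `X none ↦ 0`, `X (some v) ↦ X v` commutes with partial derivatives in the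
surviving variables: `red (∂_{some v} p) = ∂_v (red p)`. [folklore] -/
theorem aeval_optionElim_pderiv_some {σ R : Type*} [CommRing R] (v : σ)
    (p : MvPolynomial (Option σ) R) :
    aeval (fun o : Option σ => o.elim (0 : MvPolynomial σ R) X) (pderiv (some v) p) =
      pderiv v (aeval (fun o : Option σ => o.elim (0 : MvPolynomial σ R) X) p) := by
  classical
  induction p using MvPolynomial.induction_on with
  | C a => simp
  | add p q hp hq => simp only [map_add, hp, hq]
  | mul_X p o h =>
    simp only [Derivation.leibniz, pderiv_X, smul_eq_mul, map_add, map_mul, aeval_X, h]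
    cases o with
    | none => simp
    | some w =>
      simp only [Option.elim_some, pderiv_X, Pi.single_apply, Option.some.injEq]
      split_ifs <;> simp

/-- (a) The reduction `ε ↦ 0` commutes with `quotDerivNum` along words of surviving variables:
`red (quotDerivNum f g (u.map some)) = quotDerivNum (red f) (red g) u`. [folklore] -/
theorem aeval_optionElim_quotDerivNum {σ R : Type*} [CommRing R] (f g : MvPolynomial (Option σ) R)
    (u : List σ) :
    aeval (fun o : Option σ => o.elim (0 : MvPolynomial σ R) X) (quotDerivNum f g (u.map some)) =
      quotDerivNum (aeval (fun o : Option σ => o.elim (0 : MvPolynomial σ R) X) f)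
        (aeval (fun o : Option σ => o.elim (0 : MvPolynomial σ R) X) g) u := by
  induction u with
  | nil => rfl
  | cons v u ih =>
    simp only [List.map_cons, quotDerivNum_cons, map_sub, map_mul, map_nsmul,
      aeval_optionElim_pderiv_some, ih, List.length_map]

/-- (b) A common factor of numerator and denominator comes out of `quotDerivNum` as a power:
`quotDerivNum (f E) (g E) u = E^(|u|+1) · quotDerivNum f g u`. [folklore] -/
theorem quotDerivNum_mul_mul {ι R : Type*} [CommRing R] (f g E : MvPolynomial ι R) (u : List ι) :
    quotDerivNum (f * E) (g * E) u = E ^ (u.length + 1) * quotDerivNum f g u := by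
  induction u with
  | nil => simp [mul_comm]
  | cons v u ih =>
    simp only [quotDerivNum_cons, ih, pderiv_mul, pderiv_pow, List.length_cons, nsmul_eq_mul,
      Nat.cast_add, Nat.cast_one, add_tsub_cancel_right]
    ring

/-- (c) A denominator factor `c` killed by every partial derivative of the word comes out of
`quotDerivNum` as `quotDerivNum f (c g) u = c^|u| · quotDerivNum f g u`. [folklore] -/
theorem quotDerivNum_mul_denom {ι R : Type*} [CommRing R] (c f g : MvPolynomial ι R)
    (u : List ι) (hc : ∀ v ∈ u, pderiv v c = 0) :
    quotDerivNum f (c * g) u = c ^ u.length * quotDerivNum f g u := by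
  induction u with
  | nil => simp
  | cons v u ih =>
    have hcv : pderiv v c = 0 := hc v (by simp)
    have hu : ∀ w ∈ u, pderiv w c = 0 := fun w hw => hc w (by simp [hw])
    simp only [quotDerivNum_cons, ih hu, pderiv_mul, pderiv_pow, hcv, List.length_cons,
      nsmul_eq_mul, Nat.cast_add, Nat.cast_one, mul_zero, zero_mul, zero_add]
    ring

/-- **Stub `stub_quotDerivCalc`** (registered stub W1 of crux stmt-ValiantsHypothesis-5936, line
`registered`): the calculus of the quotient-derivative numerators `quotDerivNum`.
(a) the reduction `ε ↦ 0` (`X none ↦ 0`, `X (some v) ↦ X v`) commutes with `quotDerivNum` along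
words of matrix variables; (b) a common factor `E` of numerator and denominator comes out as
`E^(|u|+1)`; (c) a denominator factor `c` constant along the word comes out as `c^|u|`.
[folklore] -/
theorem stub_quotDerivCalc :
    (∀ (n : ℕ) (f g : MvPolynomial (Option (Fin n × Fin n)) ℂ) (u : List (Fin n × Fin n)),
      MvPolynomial.aeval (fun o : Option (Fin n × Fin n) => o.elim (0 : MvPolynomial (Fin n × Fin n) ℂ) MvPolynomial.X)
          (Summit.ValiantsHypothesis.ValiantsHypothesis.Theorems.ChowBorderBound.QuotDeriv.quotDerivNum f g (u.map some)) =
        Summit.ValiantsHypothesis.ValiantsHypothesis.Theorems.ChowBorderBound.QuotDeriv.quotDerivNum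
          (MvPolynomial.aeval (fun o : Option (Fin n × Fin n) => o.elim (0 : MvPolynomial (Fin n × Fin n) ℂ) MvPolynomial.X) f)
          (MvPolynomial.aeval (fun o : Option (Fin n × Fin n) => o.elim (0 : MvPolynomial (Fin n × Fin n) ℂ) MvPolynomial.X) g) u) ∧
    (∀ (ι : Type) (f g E : MvPolynomial ι ℂ) (u : List ι),
      Summit.ValiantsHypothesis.ValiantsHypothesis.Theorems.ChowBorderBound.QuotDeriv.quotDerivNum (f * E) (g * E) u =
        E ^ (u.length + 1) * Summit.ValiantsHypothesis.ValiantsHypothesis.Theorems.ChowBorderBound.QuotDeriv.quotDerivNum f g u) ∧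
    (∀ (ι : Type) (c f g : MvPolynomial ι ℂ) (u : List ι), (∀ v ∈ u, MvPolynomial.pderiv v c = 0) →
      Summit.ValiantsHypothesis.ValiantsHypothesis.Theorems.ChowBorderBound.QuotDeriv.quotDerivNum f (c * g) u =
        c ^ u.length * Summit.ValiantsHypothesis.ValiantsHypothesis.Theorems.ChowBorderBound.QuotDeriv.quotDerivNum f g u) := by
  refine ⟨?_, ?_, ?_⟩
  · intro n f g u
    exact aeval_optionElim_quotDerivNum f g u
  · intro ι f g E u
    exact quotDerivNum_mul_mul f g E u
  · intro ι c f g u hc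
    exact quotDerivNum_mul_denom c f g u hc

end Summit.ValiantsHypothesis.ValiantsHypothesis.Theorems.ChowBorderBound.QuotDerivCalc
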